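import Literature.Computability.Complexity.SpaceOracles
import Literature.Computability.Complexity.OrbitDeciderStepper
import Literature.Computability.Complexity.OrbitDecidersExists
import HarnessLib

/-!
# `SpaceOracles.lean` — proof file: the three named facts discharged; `NP^A = P^A = PSPACE` for `PSPACE`-complete `A`

Sibling proof file of `SpaceOracles.lean` (the ingredients of Homer–Selman 2011, Thm. 7.18, "if `A`
is `≤ᵖₘ`-complete for PSPACE then `NP^A = P^A`", stated there as named facts F1–F3 and assembled
conditionally). All three facts are now theorems of the tree:

* F1 `exists_isComplete_PSPACE` — `exists_isComplete_PSPACE_holds` (`SpaceTMSATHard.lean`: the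
  bounded-halting language `SPACETMSAT` of flat programs is `PSPACE`-complete; Arora–Barak 2009,
  §4.2, `SPACE TMSAT`; Homer–Selman 2011, §7.5.1, `𝒰_PS`);
* F2 `polyExists_PSPACE_subset_PSPACE` — **`polyExists_PSPACE_subset_PSPACE_holds`, proved here**:
  `L' ∈ PSPACE` has an orbit decider (`orbitDecider_of_mem_PSPACE`, `OrbitDeciderStepper.lean`),
  orbit deciders are closed under `∃ᵖ` (`OrbitDecider.polyExists`, `OrbitDecidersExists.lean`:
  enumerate the certificates in shortlex order, re-running the inner orbit in the same space —
  Homer–Selman 2011, Thm. 5.10 / Cor. 5.7), and an orbit-decided language is in `PSPACE`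
  (`OrbitDecider.mem_PSPACE`, the loop machine of `SpaceLoop.lean`);
* F3 `PRel_subset_PSPACE_of_mem_PSPACE` — `PRel_subset_PSPACE_of_mem_PSPACE_holds`
  (`OrbitDeciderStepper.lean`, through the `FP` steppers of `FPStepper.lean`; Hirahara–Lu–Ren
  2023, Rem. 2: `PSPACE^PSPACE = PSPACE`).

Hence the unconditional forms of the assembly of `SpaceOracles.lean`:
`NPRel_subset_PSPACE_of_mem_PSPACE` (`NP^A ⊆ PSPACE` for `A ∈ PSPACE`),
`PRel_eq_NPRel_of_isComplete_PSPACE` (**Homer–Selman Thm. 7.18**),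
`PRel_eq_PSPACE_of_isComplete_PSPACE` (`P^A = NP^A = PSPACE` for `PSPACE`-complete `A`,
Arora–Barak 2009, remark after Thm. 3.7), `exists_mem_PSPACE_PRel_eq_NPRel` (a `PSPACE` oracle
collapsing `NP` to `P` — Baker–Gill–Solovay's Thm. 1 with the oracle's complexity recorded),
`PRel_SPACETMSAT_eq_PSPACE`, and the by-product `polyExists_PSPACE_eq` (`∃ᵖ·PSPACE = PSPACE`).

## References

* S. Homer, A. L. Selman, *Computability and Complexity Theory*, 2nd ed., Springer 2011,
  Thm. 5.10, Cor. 5.7, Prop. 7.5 (proof), Thm. 7.18, §7.5.1. [HomerSelman2011]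
* S. Hirahara, Z. Lu, H. Ren, *Bounded relativization*, CCC 2023, LIPIcs 264, §1.1 and Rem. 2
  (p. 3). [HiraharaLuRen2023]
* S. Arora, B. Barak, *Computational Complexity: A Modern Approach*, CUP 2009, §3.4 (remark
  after Thm. 3.7), §4.1, §4.2. [AroraBarakCC2009]
* T. Baker, J. Gill, R. Solovay, *Relativizations of the P =? NP question*, SIAM J. Comput. 4
  (1975), Thm. 1. [BakerGillSolovay1975]
-/

noncomputable section

namespace Literature.Computability.Complexity

open _root_.Computability Polynomial

/-! ### F2: `∃ᵖ·PSPACE ⊆ PSPACE` -/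

/-- **Discharge of the named fact `polyExists_PSPACE_subset_PSPACE`** (`SpaceOracles.lean`, F2):
if `L' ∈ PSPACE` and `x ∈ L ↔ ∃ y, |y| ≤ p(|x|) ∧ ⟨x, y⟩ ∈ L'`, then `L ∈ PSPACE` — the orbit
decider of `L'` (`orbitDecider_of_mem_PSPACE`) is closed under `∃ᵖ` (`OrbitDecider.polyExists`:
enumerate the certificates, reusing the space of one run) and puts the language in `PSPACE`
(`OrbitDecider.mem_PSPACE`). [cite: HomerSelman2011, Thm. 5.10 and Cor. 5.7; proof of Prop. 7.5] [cite: AroraBarakCC2009, §4.1] -/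
theorem polyExists_PSPACE_subset_PSPACE_holds : polyExists_PSPACE_subset_PSPACE := by
  rintro L ⟨L', hL', p, hp⟩
  have hL : L = {x | ∃ y : List Bool, y.length ≤ p.eval x.length ∧ boolPair x y ∈ L'} :=
    Set.ext hp
  rw [hL]
  exact mem_PSPACE_polyExists_of_orbitDecider (orbitDecider_of_mem_PSPACE hL') p

/-- **`∃ᵖ·PSPACE = PSPACE`.** [cite: HomerSelman2011, Cor. 5.7 and proof of Prop. 7.5] -/
theorem polyExists_PSPACE_eq : polyExists PSPACE = PSPACE := by
  refine Set.Subset.antisymm polyExists_PSPACE_subset_PSPACE_holds fun L hL => ?_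
  refine ⟨{w | fstP w ∈ L}, ?_, 0, fun x => ?_⟩
  · exact (orbitDecider_of_mem_PSPACE hL).preimage fstP_mem_FP |>.mem_PSPACE
  · constructor
    · intro hx
      exact ⟨[], by simp, show fstP (boolPair x []) ∈ L by rwa [fstP_boolPair]⟩
    · rintro ⟨y, -, hy⟩
      have hy : fstP (boolPair x y) ∈ L := hy
      rwa [fstP_boolPair] at hy

/-! ### The assembly of `SpaceOracles.lean`, unconditionally -/

/-- **`NP^A ⊆ PSPACE` for every `A ∈ PSPACE`** ("`NP^A ⊆ NP^PSPACE ⊆ PSPACE`").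
[cite: HomerSelman2011, Thm. 7.18 (proof) and Prop. 7.5 (proof)] -/
theorem NPRel_subset_PSPACE_of_mem_PSPACE {A : Language Bool} (hA : A ∈ PSPACE) :
    NPRel (Oracle.ofLanguage A) ⊆ PSPACE :=
  NPRel_subset_PSPACE_of_mem_PSPACE_of polyExists_PSPACE_subset_PSPACE_holds
    PRel_subset_PSPACE_of_mem_PSPACE_holds hA

/-- **Homer–Selman, Thm. 7.18: if `A` is `≤ₚ`-complete for `PSPACE` then `P^A = NP^A`.**
[cite: HomerSelman2011, Thm. 7.18] -/
theorem PRel_eq_NPRel_of_isComplete_PSPACE {A : Language Bool} (hA : IsComplete PSPACE A) :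
    PRel (Oracle.ofLanguage A) = NPRel (Oracle.ofLanguage A) :=
  PRel_eq_NPRel_of_isComplete_PSPACE_of polyExists_PSPACE_subset_PSPACE_holds
    PRel_subset_PSPACE_of_mem_PSPACE_holds hA

/-- **`P^A = NP^A = PSPACE` for a `PSPACE`-complete `A`.** [cite: AroraBarakCC2009, §3.4 (remark after Thm. 3.7)] [cite: HomerSelman2011, Thm. 7.18 (proof)] -/
theorem PRel_eq_PSPACE_of_isComplete_PSPACE {A : Language Bool} (hA : IsComplete PSPACE A) :
    PRel (Oracle.ofLanguage A) = PSPACE ∧ NPRel (Oracle.ofLanguage A) = PSPACE :=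
  PRel_eq_PSPACE_of_isComplete_PSPACE_of polyExists_PSPACE_subset_PSPACE_holds
    PRel_subset_PSPACE_of_mem_PSPACE_holds hA

/-- **`P^SPACETMSAT = NP^SPACETMSAT = PSPACE`** for the tree's `PSPACE`-complete language.
[cite: AroraBarakCC2009, §3.4 (remark after Thm. 3.7) and §4.2] -/
theorem PRel_SPACETMSAT_eq_PSPACE :
    PRel (Oracle.ofLanguage SPACETMSAT) = PSPACE ∧ NPRel (Oracle.ofLanguage SPACETMSAT) = PSPACE :=
  PRel_eq_PSPACE_of_isComplete_PSPACE isComplete_PSPACE_SPACETMSAT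

/-- **A `PSPACE` oracle relative to which `P = NP`** (Baker–Gill–Solovay's Thm. 1 with the
oracle's complexity recorded): some `A ∈ PSPACE` has `P^A = NP^A`. Unconditional form of
`exists_mem_PSPACE_PRel_eq_NPRel_of`. [cite: HomerSelman2011, Thm. 7.18] [cite: BakerGillSolovay1975, Thm. 1] [cite: HiraharaLuRen2023, §1.1 (p. 3)] -/
theorem exists_mem_PSPACE_PRel_eq_NPRel :
    ∃ A : Language Bool, A ∈ PSPACE ∧ PRel (Oracle.ofLanguage A) = NPRel (Oracle.ofLanguage A) :=
  exists_mem_PSPACE_PRel_eq_NPRel_of exists_isComplete_PSPACE_holds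
    polyExists_PSPACE_subset_PSPACE_holds PRel_subset_PSPACE_of_mem_PSPACE_holds

end Literature.Computability.Complexity

end
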